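import Summits.ResolutionOfSingularities.ResolutionOfSingularities.Theorems.FrobeniusClosingPatchingRelPerfectQuotientRegularityTools
import Literature.AlgebraicGeometry.Resolution.RegularLocalRingsQuotient
import Literature.AlgebraicGeometry.Resolution.RegularLocalRingsProofs
import Literature.AlgebraicGeometry.Resolution.FieldsJ2
import Literature.AlgebraicGeometry.Resolution.AlterationsSemiStableCodimTwo
import Mathlib
import HarnessLib

/-!
# [OURS · L1 W4.5(b)] Tools for the Δ-centre toolkit D1 (iii) of the crux `EquisingularLiftNat`
# (EL♮, stmt-ResolutionOfSingularities-20038), line `sections`, research stub `stub_elnat_three`: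
# the order-one criterion read backwards, and finiteness of the non-regular locus of a reduced plane curve

NOT a statement of any manuscript. Helper file of the chain res-L1-w45b (CRUX-PLAN v3 §4, CHAIN v6.1 §3),
commutative-algebra tools consumed by `…Theorems.EquisingularLiftEquisingularLiftNatDeltaCentreRegular`
(proof of the planner's signature `DeltaRegularGeneric`, `DeltaCentreSignatures.lean` f3e4d5718baef2ab):

* `spanFinrank_maximalIdeal_le_of_mem_sq` — for `x ∈ 𝔪²` the embedding dimension of `R/(x)` is at least
  that of `R` (lift a minimal basis, Nakayama);
* `not_mem_sq_of_isRegularLocalRing_quotient` — **converse of Matsumura 14.2 for one element**: `R` regular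
  local, `x ∈ 𝔪` a non-zero-divisor, `R/(x)` regular ⇒ `x ∉ 𝔪²` (Mathlib's
  `ringKrullDim_quotient_span_singleton_succ_eq_ringKrullDim` against the previous lemma);
* `notMem_sq_of_map_notMem_sq` — "order ≥ 2" descends along the local homomorphism `A_Q → B_𝔮`
  (`Q = f⁻¹𝔮`); `mem_sq_maximalIdeal_localization_iff_of_eq` — bookkeeping under an equality of primes;
* `finite_compl_regularLocus_planeCurve` — **the non-regular locus of `k[x, y]/(ḡ)`, `ḡ ≠ 0` squarefree,
  `k` any field, is finite**: it is closed (fields are J-2: tree `isOpen_regularLocus_of_finiteType_field`,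
  Matsumura Cor. to Thm. 30.5) and contains no proper generization of any of its points (`dim ≤ 1` and the
  localisation of the reduced ring at a minimal prime is a field), so the tree's
  `Set.Finite.of_forall_specializes_eq` applies; `finite_setOf_mem_sq` — hence the primes `𝔮 ∋ ḡ` of
  `k[x, y]` with `ḡ ∈ 𝔪_𝔮²` are finitely many.
-/

set_option linter.dupNamespace false -- mandated namespace `Summit.<Summit>.<Problem>` of this single-conjunct summit

namespace Summit.ResolutionOfSingularities.ResolutionOfSingularities.Cruxes.EquisingularLiftNat.Sections

open MvPolynomial IsLocalRing Literature.AlgebraicGeometry.Resolution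
open Summit.ResolutionOfSingularities.ResolutionOfSingularities.Theorems

universe u

/-! ## Embedding dimension does not drop modulo an element of `𝔪²` -/

section EmbDim

variable {R : Type u} [CommRing R] [IsLocalRing R] [IsNoetherianRing R]

/-- If `x ∈ 𝔪²` then `emb dim R ≤ emb dim R/(x)`: a minimal basis of `𝔪/(x)` lifts to a generating
set of `𝔪` modulo `(x) ⊆ 𝔪²`, hence of `𝔪` (Nakayama). [folklore; cf. Matsumura Thm. 14.2]
[OURS · L1 W4.5b] -/
theorem spanFinrank_maximalIdeal_le_of_mem_sq {x : R} (hx2 : x ∈ maximalIdeal R ^ 2) :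
    (maximalIdeal R).spanFinrank ≤
      ((maximalIdeal R).map (Ideal.Quotient.mk (Ideal.span {x}))).spanFinrank := by
  classical
  set m := maximalIdeal R with hm
  set I := Ideal.span {x} with hI
  have hx : x ∈ m := Ideal.pow_le_self two_ne_zero hx2
  have hIm : I ≤ m := by simpa [hI, Ideal.span_le] using hx
  have hIm2 : I ≤ m ^ 2 := by simpa [hI, Ideal.span_le] using hx2
  have fg : (m.map (Ideal.Quotient.mk I)).FG := (isNoetherian_def.mp inferInstance) _
  obtain ⟨t, htcard, htspan⟩ := Submodule.FG.exists_span_finset_card_eq_spanFinrank fg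
  -- lift the generators
  let l : R ⧸ I → R := Function.surjInv Ideal.Quotient.mk_surjective
  have hl : ∀ w, Ideal.Quotient.mk I (l w) = w := Function.surjInv_eq Ideal.Quotient.mk_surjective
  let t' : Finset R := t.image l
  have hker : RingHom.ker (Ideal.Quotient.mk I) = I := Ideal.mk_ker
  -- the lifts lie in `m`
  have ht'm : Ideal.span (t' : Set R) ≤ m := by
    rw [Ideal.span_le]
    intro y hy
    simp only [Finset.coe_image, Set.mem_image, Finset.mem_coe, t'] at hy
    obtain ⟨w, hw, rfl⟩ := hy
    have : Ideal.Quotient.mk I (l w) ∈ m.map (Ideal.Quotient.mk I) := by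
      rw [hl, ← htspan]; exact Submodule.subset_span hw
    rw [← Ideal.mem_comap, Ideal.comap_map_of_surjective _ Ideal.Quotient.mk_surjective,
      ← RingHom.ker_eq_comap_bot, hker, sup_eq_left.mpr hIm] at this
    exact this
  -- `m ≤ span t' ⊔ I`
  have hmle : m ≤ Ideal.span (t' : Set R) ⊔ I := by
    intro y hy
    have hy' : Ideal.Quotient.mk I y ∈ m.map (Ideal.Quotient.mk I) := Ideal.mem_map_of_mem _ hy
    have himg : (Ideal.Quotient.mk I) '' (t' : Set R) = (t : Set (R ⧸ I)) := by
      simp only [t', Finset.coe_image, ← Set.image_comp]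
      have : (Ideal.Quotient.mk I) ∘ l = id := funext hl
      rw [this, Set.image_id]
    have h2 : m.map (Ideal.Quotient.mk I) =
        (Ideal.span (t' : Set R)).map (Ideal.Quotient.mk I) := by
      rw [Ideal.map_span, himg, ← htspan]
    rw [h2] at hy'
    have hy'' : y ∈ ((Ideal.span (t' : Set R)).map (Ideal.Quotient.mk I)).comap
        (Ideal.Quotient.mk I) := Ideal.mem_comap.mpr hy'
    rwa [Ideal.comap_map_of_surjective _ Ideal.Quotient.mk_surjective, ← RingHom.ker_eq_comap_bot,
      hker] at hy''
  -- Nakayama: `m ≤ span t' ⊔ m • m` forces `m ≤ span t'`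
  have hmle' : m ≤ Ideal.span (t' : Set R) ⊔ m • m := by
    refine le_trans hmle (sup_le_sup_left ?_ _)
    rw [Ideal.smul_eq_mul, ← pow_two]
    exact hIm2
  have hfg : m.FG := (isNoetherian_def.mp inferInstance) _
  have hle : m ≤ Ideal.span (t' : Set R) :=
    Submodule.le_of_le_smul_of_le_jacobson_bot hfg (maximalIdeal_le_jacobson _) hmle'
  have heq : m = Ideal.span (t' : Set R) := le_antisymm hle ht'm
  calc m.spanFinrank = (Ideal.span (t' : Set R)).spanFinrank := by rw [← heq]
    _ ≤ (t' : Set R).ncard := Submodule.spanFinrank_span_le_ncard_of_finite t'.finite_toSet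
    _ ≤ t.card := by
        simp only [Set.ncard_coe_finset, t']
        exact Finset.card_image_le
    _ = _ := htcard

end EmbDim

/-! ## A regular local ring modulo a non-zero-divisor of `𝔪²` is never regular -/

/-- **Converse of Matsumura 14.2 for one element.** If `(R, 𝔪)` is a regular local ring, `x ∈ 𝔪` is a
non-zero-divisor and `R/(x)` is again a regular local ring, then `x ∉ 𝔪²` (`dim R/(x) + 1 = dim R`,
Mathlib `ringKrullDim_quotient_span_singleton_succ_eq_ringKrullDim`, while for `x ∈ 𝔪²` the embedding
dimension does not drop, `spanFinrank_maximalIdeal_le_of_mem_sq`). [folklore; cf. Matsumura Thm. 14.2]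
[OURS · L1 W4.5b] -/
theorem not_mem_sq_of_isRegularLocalRing_quotient {R : Type u} [CommRing R] [IsRegularLocalRing R]
    {x : R} (hx : x ∈ maximalIdeal R) (hreg : IsSMulRegular R x)
    (h : IsRegularLocalRing (R ⧸ Ideal.span {x})) : x ∉ maximalIdeal R ^ 2 := by
  intro hx2
  haveI := h
  haveI : Nontrivial (R ⧸ Ideal.span {x}) :=
    Ideal.Quotient.nontrivial_iff.mpr (Ideal.span_singleton_ne_top
      (fun hu => (IsLocalRing.mem_maximalIdeal x).mp hx hu))
  have hdim := ringKrullDim_quotient_span_singleton_succ_eq_ringKrullDim hreg hx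
  have h1 := (isRegularLocalRing_iff R).mp ‹IsRegularLocalRing R›
  have h2 := (isRegularLocalRing_iff (R ⧸ Ideal.span {x})).mp h
  rw [maximalIdeal_quotient_eq_map (Ideal.span {x})] at h2
  have hle := spanFinrank_maximalIdeal_le_of_mem_sq hx2
  set a := (maximalIdeal R).spanFinrank with ha
  set b := ((maximalIdeal R).map (Ideal.Quotient.mk (Ideal.span {x}))).spanFinrank with hb
  rw [← h1, ← h2] at hdim
  have hab : b + 1 = a := by exact_mod_cast hdim
  omega

/-! ## Transport of "order ≥ 2" along a local homomorphism of localisations -/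

/-- If `f : A → B`, `Q = f⁻¹(𝔮)` and the image of `G` in `B_𝔮` is NOT in `𝔪_𝔮²`, then the image of `G`
in `A_Q` is not in `𝔪_Q²` (the induced local homomorphism `A_Q → B_𝔮` maps `𝔪_Q²` into `𝔪_𝔮²`).
[folklore] [OURS · L1 W4.5b] -/
theorem notMem_sq_of_map_notMem_sq {A B : Type u} [CommRing A] [CommRing B] (f : A →+* B)
    (𝔮 : Ideal B) [𝔮.IsPrime] (Q : Ideal A) [Q.IsPrime] (hQ : Q = 𝔮.comap f) {G : A}
    (h : algebraMap B (Localization.AtPrime 𝔮) (f G) ∉ maximalIdeal (Localization.AtPrime 𝔮) ^ 2) :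
    algebraMap A (Localization.AtPrime Q) G ∉ maximalIdeal (Localization.AtPrime Q) ^ 2 := by
  intro hG
  apply h
  set φ := Localization.localRingHom Q 𝔮 f hQ with hφ
  have hφG : φ (algebraMap A (Localization.AtPrime Q) G) =
      algebraMap B (Localization.AtPrime 𝔮) (f G) := Localization.localRingHom_to_map Q 𝔮 f hQ G
  rw [← hφG]
  have hmap : (maximalIdeal (Localization.AtPrime Q)).map φ ≤ maximalIdeal (Localization.AtPrime 𝔮) :=
    Ideal.map_le_iff_le_comap.mpr fun a ha => map_nonunit φ a ha
  have h1 : φ (algebraMap A (Localization.AtPrime Q) G) ∈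
      ((maximalIdeal (Localization.AtPrime Q)) ^ 2).map φ := Ideal.mem_map_of_mem _ hG
  rw [Ideal.map_pow] at h1
  exact Ideal.pow_right_mono hmap 2 h1

/-- Changing the prime by an equality of ideals does not change membership in `𝔪²` of the
localisation (bookkeeping). [folklore] [OURS · L1 W4.5b] -/
theorem mem_sq_maximalIdeal_localization_iff_of_eq {A : Type u} [CommRing A] {P₁ P₂ : Ideal A}
    [P₁.IsPrime] [P₂.IsPrime] (h : P₁ = P₂) (a : A) :
    algebraMap A (Localization.AtPrime P₁) a ∈ maximalIdeal (Localization.AtPrime P₁) ^ 2 ↔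
      algebraMap A (Localization.AtPrime P₂) a ∈ maximalIdeal (Localization.AtPrime P₂) ^ 2 := by
  subst h
  exact Iff.rfl

/-! ## Finiteness of the non-regular points of a reduced plane curve -/

section PlaneCurve

variable {k : Type} [Field k]

/-- `k[x, y]` has Krull dimension `2`. [folklore] -/
theorem ringKrullDim_mvPolynomial_fin_two : ringKrullDim (MvPolynomial (Fin 2) k) = 2 := by
  rw [MvPolynomial.ringKrullDim_of_isNoetherianRing, ringKrullDim_eq_zero_of_field]
  simp

/-- Arithmetic in `WithBot ℕ∞`: `d + 1 ≤ 2 → d ≤ 1`. [folklore] -/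
theorem withBot_enat_le_one_of_add_one_le_two {d : WithBot ℕ∞} (h : d + 1 ≤ 2) : d ≤ 1 := by
  induction d using WithBot.recBotCoe with
  | bot => exact bot_le
  | coe e =>
    have h2 : e + 1 ≤ 2 := by
      have h' : ((e + 1 : ℕ∞) : WithBot ℕ∞) ≤ ((2 : ℕ∞) : WithBot ℕ∞) := by
        rw [WithBot.coe_add, WithBot.coe_one]; exact h
      exact WithBot.coe_le_coe.mp h'
    have he : e ≠ ⊤ := by
      rintro rfl
      exact absurd h2 (by decide)
    have h3 : e < 2 := (ENat.add_one_le_iff he).mp h2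
    have h4 : e ≤ 1 := by
      rw [show (2 : ℕ∞) = 1 + 1 from one_add_one_eq_two.symm] at h3
      exact (ENat.lt_add_one_iff ENat.one_ne_top).mp h3
    exact_mod_cast h4

/-- The reduced plane curve `k[x, y]/(ḡ)` (`ḡ ≠ 0`) has Krull dimension `≤ 1`. [folklore] -/
theorem ringKrullDim_planeCurve_le_one {gbar : MvPolynomial (Fin 2) k} (hg0 : gbar ≠ 0) :
    ringKrullDim (MvPolynomial (Fin 2) k ⧸ Ideal.span {gbar}) ≤ 1 := by
  apply withBot_enat_le_one_of_add_one_le_two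
  have := ringKrullDim_quotient_succ_le_of_nonZeroDivisor (mem_nonZeroDivisors_of_ne_zero hg0)
  rwa [ringKrullDim_mvPolynomial_fin_two] at this

/-- For a reduced plane curve `C = k[x, y]/(ḡ)` (`ḡ ≠ 0` squarefree): the localisation of `C` at a prime
properly contained in another prime is a field (such a prime is minimal since `dim C ≤ 1`, and `C` is
reduced). [folklore] [OURS · L1 W4.5b] -/
theorem isField_localization_of_lt {gbar : MvPolynomial (Fin 2) k} (hg0 : gbar ≠ 0)
    (hsq : Squarefree gbar) (y x : PrimeSpectrum (MvPolynomial (Fin 2) k ⧸ Ideal.span {gbar}))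
    (hyx : y < x) : IsField (Localization.AtPrime y.asIdeal) := by
  -- `C` is reduced
  have hrad : (Ideal.span {gbar}).IsRadical := (isRadical_iff_span_singleton).mp hsq.isRadical
  haveI : IsReduced (MvPolynomial (Fin 2) k ⧸ Ideal.span {gbar}) :=
    (Ideal.isRadical_iff_quotient_reduced _).mp hrad
  -- heights: `ht y + 1 ≤ ht x ≤ dim C ≤ 1`
  have hlt : y.asIdeal < x.asIdeal := hyx
  have h1 := Ideal.height_add_one_le_of_lt_of_isPrime hlt
  have hx1 : (x.asIdeal.height : WithBot ℕ∞) ≤ 1 :=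
    le_trans Ideal.height_le_ringKrullDim_of_isPrime (ringKrullDim_planeCurve_le_one hg0)
  have hx1' : x.asIdeal.height ≤ 1 := by exact_mod_cast hx1
  have hy0 : y.asIdeal.height = 0 := by
    have h2 : y.asIdeal.height + 1 ≤ 1 := le_trans h1 hx1'
    have hytop : y.asIdeal.height ≠ ⊤ := by
      intro htop
      rw [htop, top_add] at h2
      exact ENat.one_ne_top (top_le_iff.mp h2)
    have h3 : y.asIdeal.height < 1 := (ENat.add_one_le_iff hytop).mp h2
    exact Order.lt_one_iff.mp h3
  have hmin : y.asIdeal ∈ minimalPrimes (MvPolynomial (Fin 2) k ⧸ Ideal.span {gbar}) :=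
    Ideal.height_eq_zero_iff.mp hy0
  haveI : Ring.KrullDimLE 0 (Localization.AtPrime y.asIdeal) :=
    Ring.KrullDimLE.of_isLocalization y.asIdeal hmin _
  exact Ring.KrullDimLE.isField_of_isReduced

/-- **The non-regular locus of a reduced plane curve is finite**: for `ḡ ≠ 0` squarefree in `k[x, y]`
(`k` any field), `C = k[x, y]/(ḡ)` has finitely many primes `𝔭` with `C_𝔭` not regular (the non-regular
locus is closed since fields are J-2, and contains no proper generization since those localisations are
fields). [folklore; Matsumura Cor. to Thm. 30.5] [OURS · L1 W4.5b] -/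
theorem finite_compl_regularLocus_planeCurve {gbar : MvPolynomial (Fin 2) k} (hg0 : gbar ≠ 0)
    (hsq : Squarefree gbar) :
    (regularLocus (MvPolynomial (Fin 2) k ⧸ Ideal.span {gbar}))ᶜ.Finite := by
  have hclosed : IsClosed (regularLocus (MvPolynomial (Fin 2) k ⧸ Ideal.span {gbar}))ᶜ :=
    (isOpen_regularLocus_of_finiteType_field k (MvPolynomial (Fin 2) k ⧸ Ideal.span {gbar})).isClosed_compl
  refine Set.Finite.of_forall_specializes_eq hclosed subset_rfl fun x _ y hy hyx => ?_
  rw [← PrimeSpectrum.le_iff_specializes] at hyx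
  rcases hyx.lt_or_eq with hlt | heq
  · exfalso
    apply hy
    rw [mem_regularLocus]
    letI : Field (Localization.AtPrime y.asIdeal) := (isField_localization_of_lt hg0 hsq y x hlt).toField
    infer_instance
  · exact heq

/-- For `ḡ ≠ 0` squarefree in `B = k[x, y]`: the primes `𝔮 ∋ ḡ` of `B` with `ḡ ∈ 𝔪_𝔮²` (in `B_𝔮`) are
finitely many — they inject into the non-regular locus of `B/(ḡ)` (if `(B/(ḡ))_𝔮 = B_𝔮/(ḡ)` were regular,
`ḡ ∉ 𝔪_𝔮²` by `not_mem_sq_of_isRegularLocalRing_quotient`). [folklore] [OURS · L1 W4.5b] -/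
theorem finite_setOf_mem_sq {gbar : MvPolynomial (Fin 2) k} (hg0 : gbar ≠ 0) (hsq : Squarefree gbar) :
    {𝔮 : PrimeSpectrum (MvPolynomial (Fin 2) k) | gbar ∈ 𝔮.asIdeal ∧
      algebraMap (MvPolynomial (Fin 2) k) (Localization.AtPrime 𝔮.asIdeal) gbar ∈
        maximalIdeal (Localization.AtPrime 𝔮.asIdeal) ^ 2}.Finite := by
  let θ : PrimeSpectrum (MvPolynomial (Fin 2) k ⧸ Ideal.span {gbar}) →
      PrimeSpectrum (MvPolynomial (Fin 2) k) :=
    PrimeSpectrum.comap (Ideal.Quotient.mk (Ideal.span {gbar}))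
  refine ((finite_compl_regularLocus_planeCurve hg0 hsq).image θ).subset ?_
  rintro 𝔮 ⟨hgq, hsq2⟩
  have hJq : Ideal.span {gbar} ≤ 𝔮.asIdeal := by
    rw [Ideal.span_singleton_le_iff_mem]; exact hgq
  obtain ⟨hprime, hcomap⟩ := isPrime_map_mk_and_comap_eq (Ideal.span {gbar}) 𝔮.asIdeal hJq
  refine ⟨⟨𝔮.asIdeal.map (Ideal.Quotient.mk (Ideal.span {gbar})), hprime⟩, ?_, ?_⟩
  · -- the point of `C` is not regular
    intro hreg
    rw [mem_regularLocus] at hreg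
    haveI := hprime
    have h2 := (isRegularLocalRing_localization_quotient_iff (Ideal.span {gbar}) 𝔮.asIdeal
      (𝔮.asIdeal.map (Ideal.Quotient.mk (Ideal.span {gbar}))) hcomap).mp hreg
    have hJ' : (Ideal.span {gbar}).map
        (algebraMap (MvPolynomial (Fin 2) k) (Localization.AtPrime 𝔮.asIdeal)) =
        Ideal.span {algebraMap (MvPolynomial (Fin 2) k) (Localization.AtPrime 𝔮.asIdeal) gbar} := by
      rw [Ideal.map_span, Set.image_singleton]
    rw [hJ'] at h2
    haveI : IsRegularLocalRing (Localization.AtPrime 𝔮.asIdeal) :=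
      IsRegularRing.isRegularLocalRing_localization 𝔮.asIdeal
    have hmem : algebraMap (MvPolynomial (Fin 2) k) (Localization.AtPrime 𝔮.asIdeal) gbar ∈
        maximalIdeal (Localization.AtPrime 𝔮.asIdeal) := by
      rw [← Localization.AtPrime.map_eq_maximalIdeal]
      exact Ideal.mem_map_of_mem _ hgq
    have hinj : Function.Injective
        (algebraMap (MvPolynomial (Fin 2) k) (Localization.AtPrime 𝔮.asIdeal)) :=
      IsLocalization.injective (Localization.AtPrime 𝔮.asIdeal) 𝔮.asIdeal.primeCompl_le_nonZeroDivisors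
    have hne : algebraMap (MvPolynomial (Fin 2) k) (Localization.AtPrime 𝔮.asIdeal) gbar ≠ 0 := by
      rw [Ne, ← map_zero (algebraMap (MvPolynomial (Fin 2) k) (Localization.AtPrime 𝔮.asIdeal)),
        hinj.eq_iff]
      exact hg0
    have hreg' : IsSMulRegular (Localization.AtPrime 𝔮.asIdeal)
        (algebraMap (MvPolynomial (Fin 2) k) (Localization.AtPrime 𝔮.asIdeal) gbar) :=
      (IsRegular.of_ne_zero hne).left.isSMulRegular
    exact not_mem_sq_of_isRegularLocalRing_quotient hmem hreg' h2 hsq2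
  · exact PrimeSpectrum.ext hcomap

end PlaneCurve

end Summit.ResolutionOfSingularities.ResolutionOfSingularities.Cruxes.EquisingularLiftNat.Sections
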